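import Summits.Ventures.YMGap.RobustBall.ZNGaugePeeling
import HarnessLib

/-!
# RobustBall/CentreBlindAreaLaw — THE WINDOW-FREE, BALL-FREE AREA LAW FOR LINKWISE CENTRE-BLIND PERTURBATIONS
# (ROBUST-BALL-STATEMENT §6(c)): `AreaLawCentreBlind N d β` for every `N ≥ 2` and `2(d−1)·N·|β| < 1`

HONEST FRAMING: venture file of the cell `pub-ymgap` (QuantumFields programme), track Y2 ROBUST-BALL, seat ds-4 g7
(lead R222 GO; rb-theory's reserved names `IsCentreBlind`, `AreaLawCentreBlind`).  STRONG-COUPLING LATTICE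
STATEMENTS ONLY, on finite tori `(ℤ/L)^d`, uniformly in `L`; fundamental (`N`-ality one) Wilson loops; the
`β`-window `2(d−1)N|β| < 1` (SU(2), `d = 4`: `β_W = 2β < 1/6`) is SMALLER than the tier-1 ball's; nothing about
the continuum limit, a spectral gap, or a Clay-sense mass gap.

THE THEOREM (`areaLawCentreBlind`, rb-theory's currency verbatim = the body of `AreaLawOnBall` with the ball
and the vertical window replaced by `IsCentreBlind W`): for `N ≥ 2` and `2(d−1)·N·|β| < 1` there are `C, c > 0`
such that for EVERY torus `L`, EVERY perturbation `W` of the `SU(N)` Wilson action that is LINKWISE centre-blind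
— `W.total (ζ • U) = W.total U` for every `ζ : links → centre SU(N)`; NO smallness, NO range, NO window; this
class contains the adjoint / mixed fundamental–adjoint plaquette and loop actions of ANY size, `|tr U_C|²` terms, …
— and every non-wrapping `R × T` rectangle,
`|⟨(1/N) Re tr U_{∂R×T}⟩_{β,W,L}| ≤ C^{2(R+T)} e^{−c·RT}`; explicitly (`abs_wilsonLoop_le_of_isTwistBlind`)
`|⟨W_{R×T}⟩| ≤ 4^R · c₀^{RT}`, `c₀ = 2(d−1)N|β|` (SU(2), `d = 4`, `β_W = 1/8`: `4^R (3/4)^{RT}`).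

PROOF = centre projection (Fröhlich 1979, Mack–Petkova 1979: `CentreProjection`) + the uniform Durhuus–Fröhlich
layer bound for the induced INHOMOGENEOUS `ℤ_N` gauge theory (`ZNGaugePeeling`, through the tree's measure-free
Dobrushin comparison `Dobrushin.DustingData.abs_sub_le_sum_pow`).  Why §6(c)'s «slabs stay coupled through `W`»
objection (v1.21, K1 residual 1) does not apply: after the projection `W` never reaches the `ℤ_N` sector, whose
action is pure plaquette.  Why §6(a)'s negative `not_areaLawOnBallC` is consistent: its screening member (a
fundamental loop term) is slab-wise but not LINKWISE centre invariant.  Ceiling of any statement uniform over the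
class (SU(2), `d = 4`): the `β_A → ∞` member is 4D `ℤ_2` gauge theory, deconfining at `β_W ≈ 0.44`.

Also: consistency with the tree's `HasAreaLaw` (`hasAreaLaw_of_small`: Wilson's area law for every `SU(N)`,
`N ≥ 2`, every `d`, at `2(d−1)N|β| < 1`, a second independent proof next to the slab criterion).

References (mechanism, as printed): J. Fröhlich, Phys. Lett. B 83 (1979) 195–198; G. Mack, V. B. Petkova,
Ann. Phys. 123 (1979) 442–467, §2; B. Durhuus, J. Fröhlich, Comm. Math. Phys. 75 (1980) 103–151.
-/

noncomputable section

open Finset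
open Literature.MathematicalPhysics.QuantumLattice (fundamentalRep)
open Literature.MathematicalPhysics.QuantumFieldTheory

namespace Summit.Ventures.YMGap.RobustBall

variable {d L N : ℕ}

/-! ### The currency (rb-theory's reserved name, ROBUST-BALL-STATEMENT §6(c)) -/

/-- **`AreaLawCentreBlind N d β`** (rb-theory, 2026-08-23, §6(c) of ROBUST-BALL-STATEMENT; the body of
`AreaLawOnBall` with `W ∈ ClusterDomainFR ε₀ ε₁ r → IsSlabLocal mv W →` replaced by `IsCentreBlind W →` — NO radii,
NO range, NO window): constants `C, c > 0` such that for every torus `L`, every LINKWISE centre-blind perturbation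
`W` and every non-wrapping `R × T` rectangle, `|⟨W_{R×T}⟩_{β,W,L}| ≤ C^{2(R+T)} e^{−c RT}`. [folklore] -/
def AreaLawCentreBlind (N d : ℕ) (β : ℝ) : Prop :=
  ∃ C c : ℝ, 0 < c ∧ ∀ (L : ℕ) [NeZero L] (W : Perturbation d L N), IsCentreBlind W →
    ∀ (x : Site d L) (i j : Fin d) (R T : ℕ), i ≠ j → 1 ≤ R → 1 ≤ T → 2 * R ≤ L → 2 * T ≤ L →
      |W.expectation (fundamentalRep (Fin N)) β (wilsonLoop (fundamentalRep (Fin N)) x i j R T)| ≤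
        C ^ (2 * (R + T)) * Real.exp (-c * (R * T))

/-! ### The explicit bound -/

/-- **Explicit area-law bound for twist-blind perturbations**: `N ≥ 2`, `c₀ = 2(d−1)N|β| ≤ c ≤ 1`, `W`
twist-blind (in particular linkwise centre-blind), `i ≠ j`, `2R, 2T ≤ L` ⇒
`|⟨W_{R×T}⟩_{β,W,L}| ≤ (4 c^T)^R`. [folklore] -/
theorem abs_wilsonLoop_le_of_isTwistBlind [NeZero L] [NeZero N] (hN : 2 ≤ N) {β c : ℝ}
    (hc : 2 * ((d - 1 : ℕ) : ℝ) * |β| * N ≤ c) (hc1 : c ≤ 1) (W : Perturbation d L N) (hW : IsTwistBlind W)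
    (x : Site d L) {i j : Fin d} (hij : i ≠ j) {R T : ℕ} (hR : 2 * R ≤ L) (hT : 2 * T ≤ L) :
    |W.expectation (fundamentalRep (Fin N)) β (wilsonLoop (fundamentalRep (Fin N)) x i j R T)| ≤ (4 * c ^ T) ^ R :=
  abs_expectation_wilsonLoop_le_of_isTwistBlind W hW β x i j R T fun U => norm_znLoop_le hN β hc hc1 U x hij hR hT

/-- `(4 c^T)^R ≤ 2^{2(R+T)} · e^{log c · RT}` for `0 < c`: the explicit bound in the area-law shape. [folklore] -/
theorem pow_bound_le_areaLawShape {c : ℝ} (hc0 : 0 < c) (R T : ℕ) :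
    (4 * c ^ T) ^ R ≤ (2 : ℝ) ^ (2 * (R + T)) * Real.exp (-(-Real.log c) * ((R : ℝ) * T)) := by
  have e1 : Real.exp (-(-Real.log c) * ((R : ℝ) * T)) = c ^ (R * T) := by
    rw [neg_neg, show Real.log c * ((R : ℝ) * T) = ((R * T : ℕ) : ℝ) * Real.log c by push_cast; ring,
      Real.exp_nat_mul, Real.exp_log hc0]
  have e2 : (4 * c ^ T) ^ R = (4 : ℝ) ^ R * c ^ (R * T) := by rw [mul_pow, ← pow_mul, mul_comm T R]
  have e3 : (2 : ℝ) ^ (2 * (R + T)) = 4 ^ (R + T) := by rw [pow_mul]; norm_num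
  rw [e1, e2, e3]
  exact mul_le_mul_of_nonneg_right (pow_le_pow_right₀ (by norm_num) (Nat.le_add_right R T)) (pow_nonneg hc0.le _)

/-! ### The theorem -/

/-- **THE WINDOW-FREE, BALL-FREE AREA LAW FOR LINKWISE CENTRE-BLIND PERTURBATIONS** (ROBUST-BALL-STATEMENT
§6(c) — until 2026-08-23 «OPEN, method null»): for every `N ≥ 2`, every `d` and every tree coupling `β` with
`2(d−1)·N·|β| < 1`, `AreaLawCentreBlind N d β` holds, with `C = 2` and rate `c = −log max(2(d−1)N|β|, 1/2)`.
HONEST LABEL: strong-coupling lattice statement, finite tori uniformly in `L`, fundamental loops; `β`-window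
smaller than tier 1's; nothing continuum / spectral / Clay. [cite: Frohlich1979ZN, Eq. (7)–(9)] -/
theorem areaLawCentreBlind (hN : 2 ≤ N) {β : ℝ} (hβ : 2 * ((d - 1 : ℕ) : ℝ) * |β| * N < 1) :
    AreaLawCentreBlind N d β := by
  haveI : NeZero N := ⟨by omega⟩
  set c := max (2 * ((d - 1 : ℕ) : ℝ) * |β| * N) (1 / 2) with hcdef
  have hc0 : 0 < c := lt_max_of_lt_right (by norm_num)
  have hc1 : c < 1 := max_lt hβ (by norm_num)
  have hcle : 2 * ((d - 1 : ℕ) : ℝ) * |β| * N ≤ c := le_max_left _ _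
  refine ⟨2, -Real.log c, neg_pos.2 (Real.log_neg hc0 hc1), fun L _ W hW x i j R T hij _ _ hRL hTL => ?_⟩
  exact (abs_wilsonLoop_le_of_isTwistBlind hN hcle hc1.le W hW.isTwistBlind x hij hRL hTL).trans
    (pow_bound_le_areaLawShape hc0 R T)

/-- **SU(2), `d = 4`**: the window-free centre-blind area law for `|β| < 1/12`, i.e. `β_W = 2β < 1/6`. [folklore] -/
theorem su2_areaLawCentreBlind_dim4 {β : ℝ} (hβ : |β| < 1 / 12) : AreaLawCentreBlind 2 4 β :=
  areaLawCentreBlind (le_refl 2) (by push_cast; linarith)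

/-- **SU(2), `d = 3`**: the window-free centre-blind area law for `|β| < 1/8`, i.e. `β_W < 1/4`. [folklore] -/
theorem su2_areaLawCentreBlind_dim3 {β : ℝ} (hβ : |β| < 1 / 8) : AreaLawCentreBlind 2 3 β :=
  areaLawCentreBlind (le_refl 2) (by push_cast; linarith)

/-- **SU(3), `d = 4`**: the window-free centre-blind area law for `|β| < 1/18`. [folklore] -/
theorem su3_areaLawCentreBlind_dim4 {β : ℝ} (hβ : |β| < 1 / 18) : AreaLawCentreBlind 3 4 β :=
  areaLawCentreBlind (by norm_num) (by push_cast; linarith)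

/-- **Every `SU(N)`, `d = 4`, in 't Hooft scaling**: the window-free centre-blind area law at tree coupling
`β = N·βt` whenever `6 N² |βt| < 1`. [folklore] -/
theorem suN_areaLawCentreBlind_dim4 (hN : 2 ≤ N) {βt : ℝ} (hβ : 6 * (N : ℝ) ^ 2 * |βt| < 1) :
    AreaLawCentreBlind N 4 ((N : ℝ) * βt) :=
  areaLawCentreBlind hN (by
    have hNn : (0 : ℝ) ≤ N := Nat.cast_nonneg N
    rw [abs_mul, abs_of_nonneg hNn]; push_cast; nlinarith)

/-- **The SU(2) `d = 4` row at `β_W = 1/8`** (tree `β = 1/16`), explicit constants: every twist-blind (in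
particular every linkwise centre-blind) perturbation `W`, every torus, every non-wrapping `R × T` loop:
`|⟨W_{R×T}⟩_{1/16,W,L}| ≤ (4 · (3/4)^T)^R` — rate `log(4/3) ≈ 0.2877` per plaquette. [folklore] -/
theorem su2_wilsonLoop_le_oneEighth [NeZero L] (W : Perturbation 4 L 2) (hW : IsTwistBlind W) (x : Site 4 L)
    {i j : Fin 4} (hij : i ≠ j) {R T : ℕ} (hR : 2 * R ≤ L) (hT : 2 * T ≤ L) :
    |W.expectation (fundamentalRep (Fin 2)) (1 / 16) (wilsonLoop (fundamentalRep (Fin 2)) x i j R T)| ≤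
      (4 * (3 / 4 : ℝ) ^ T) ^ R :=
  abs_wilsonLoop_le_of_isTwistBlind (le_refl 2) (by norm_num [abs_of_pos]) (by norm_num) W hW x hij hR hT

/-! ### Consistency: Wilson's area law (`W = 0`) -/

/-- **Wilson's area law from centre projection** (consistency; a second, slab-free proof of the tree's
`HasAreaLaw` at strong coupling): every `SU(N)`, `N ≥ 2`, every `d`, `2(d−1)N|β| < 1`. [folklore] -/
theorem hasAreaLaw_of_small (hN : 2 ≤ N) {β : ℝ} (hβ : 2 * ((d - 1 : ℕ) : ℝ) * |β| * N < 1) :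
    HasAreaLaw d (fundamentalRep (Fin N)) β := by
  obtain ⟨C, c, hc, h⟩ := areaLawCentreBlind (d := d) hN hβ
  refine ⟨C, c, hc, fun L _ x i j R T hij hR hT hRL hTL => ?_⟩
  have h0 := h L 0 isCentreBlind_zero x i j R T hij hR hT hRL hTL
  rwa [QuasiLocalGaugePerturbation.expectation_zero] at h0

/-! ### The ball-shaped corollary (tier-2 ball, no window): the ball hypothesis is idle -/

/-- **Window-free tier-2 area law on the centre-blind sub-ball** (the literal §6(c) shape: members of the
diameter-weighted ball `ClusterDomain κ ε₀ ε₁` that are linkwise centre-blind, NO vertical window): holds for every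
`κ, ε₀, ε₁` — the ball hypothesis is simply dropped. [folklore] -/
theorem areaLaw_clusterDomain_centreBlind (hN : 2 ≤ N) {β : ℝ} (hβ : 2 * ((d - 1 : ℕ) : ℝ) * |β| * N < 1)
    (κ ε₀ ε₁ : ℝ) :
    ∃ C c : ℝ, 0 < c ∧ ∀ (L : ℕ) [NeZero L] (W : Perturbation d L N), W ∈ ClusterDomain κ ε₀ ε₁ →
      IsCentreBlind W → ∀ (x : Site d L) (i j : Fin d) (R T : ℕ), i ≠ j → 1 ≤ R → 1 ≤ T → 2 * R ≤ L → 2 * T ≤ L →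
        |W.expectation (fundamentalRep (Fin N)) β (wilsonLoop (fundamentalRep (Fin N)) x i j R T)| ≤
          C ^ (2 * (R + T)) * Real.exp (-c * (R * T)) := by
  obtain ⟨C, c, hc, h⟩ := areaLawCentreBlind (d := d) hN hβ
  exact ⟨C, c, hc, fun L _ W _ hW => h L W hW⟩

end Summit.Ventures.YMGap.RobustBall

end
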